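/-
Copyright (c) 2026 the pub-hodgecm-mathlib formalisation cell (harness21).  Prover seat hodgecm-mathlib-F0P2-p02 (g26); E1 BRICK LEDGER row 46′ «the K4′ Jacquet alternative WITH
its sub-line clauses» (sibling of ★ row 40′ `CharacterSelfExtensionJacquetAlternative` p853320 (F0P3b-p01 (g25)); consumer ★ row 46 D′46 `F0P3cStCharTSK4PrimeSelfExtSplit`).
-/
import Literature.RepresentationTheory.CharacterSelfExtensionJacquetAlternative   -- ★ row 40′ p853320: `exists_scalar_additive`, `two_le_finrank_intertwiningMap_of_split` (brings ★ CHAR-EXT B `exists_linearEquiv_unipotent_model`)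
import HarnessLib

/-!
# The alternative of a self-extension of a character, WITH THE SUB LINE: in the non-split branch the intertwiner `θ : N → N₀` onto the unipotent model sends the sub `ker p = k·e`
# INTO the sub `0 × k` of the model and is non-zero there (`θ e = (0, 1)`)

Generic representation theory over a field `k` (any monoid `M`), Mathlib + ★ `CharacterSelfExtensionJacquetAlternative` ∕ ★ `CharacterSelfExtensionModel`, THEOREMS ONLY (no `def`, no
instance, no notation, no named fact).  Namespace `Literature.RepresentationTheory`; letters of ★ row 40′ VERBATIM: `N : Representation k M U` a SELF-EXTENSION OF THE CHARACTER `χ`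
(`p : U →ₗ k`, `hquot`, `hker`, base vector `u₀` with `p u₀ = 1`, `ker p` the free line on `e` — `he`, `hline`, `hfree`), `χ₁` the `χ`-line (`hχ₁`), the unipotent model `N₀` in
the JET letters `N₀ m (w₁, w₂) = (χ m w₁, λ m χ m w₁ + χ m w₂)` (sub `0 × k`, quotient = first coordinate).

★ row 40′ proves the JACQUET ALTERNATIVE «`2 ≤ dim_k Hom_M(N, χ₁)` (split) OR `∃ θ : N → N₀` with `(θ u₀).1 ≠ 0` (non-split)» — the (d1′) input of the K2′-π² assembly (★ row 40 D).  Its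
K4′ twin (★ row 46 D′46 `exists_section_selfExtension_of_jacquet_alternative_of_jet_intertwiner`, over ★ G3 `two_le_finrank_intertwiningMap_of_jet_sign`) needs, in the non-split
branch, TWO MORE CLAUSES about the SAME `θ`: it sends the sub line `ker p` into the sub `0 × k` of the model (`∀ w, p w = 0 → (θ w).1 = 0`) and does not kill it (`θ e ≠ 0`).  Both are
immediate from ★ CHAR-EXT B's universal isomorphism `Φ (x, y) = x e + y u₀` (`Φ⁻¹ e = (1, 0)`, so after the coordinate swap `θ e = (0, 1)`):
* §1 **`exists_intertwiningMap_unipotentModel_of_not_split_sub`**: non-split ⇒ `λ ≠ 0` additive and, for every `N₀` of shape `λ`, an intertwiner `θ : N → N₀` with `θ u₀ = (1, λ-free) …`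
  precisely `(θ u₀).1 = 1`, `θ e = (0, 1)`, hence `∀ w ∈ ker p, (θ w).1 = 0`; the OCCURRENCE relation `N m u₀ − χ m u₀ = χ m λ(m) e` is returned too (as ★ 40′ ED. 2's primed heads do), so a
  consumer's height oracle ∕ jet-intertwiner hypothesis may carry the occurrence antecedent.
* §2 **`jacquetAlternative_of_selfExtension_char_sub`** — `(2 ≤ finrank k (IntertwiningMap N χ₁)) ∨ ∃ λ ≠ 0 additive OCCURRING in N, ∀ N₀ of shape λ, ∃ θ : N → N₀, (∃ y, (θ y).1 ≠ 0) ∧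
  (∀ w, p w = 0 → (θ w).1 = 0) ∧ θ e ≠ 0` = ★ D′46's `hJ` once the consumer identifies `ker p` with `r_P(ι)(r_P A)` (its input class «`r_B` exact, `r_B π⁺` the `θ̃`-line»).
[cite: Brown1982, Ch. IV §2 Prop. 2.1 p. 87, Prop. 2.3 p. 89] [cite: Keys1984, §3 pp. 118–119; §4 Thm. 3 p. 120] [cite: BernsteinZelevinsky1977, §2.3]
HONEST LABEL: count-neutral generic layer; WHICH `λ` occurs, and the jet intertwiner (J) for its height jet, stay the consumer's hypotheses; HC_CM is proved only modulo the printed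
citations of that programme until its rung 0 closes.

## References
* [Brown1982] K. S. Brown, *Cohomology of Groups*, GTM 87 (1982), Ch. IV §2 Prop. 2.1 p. 87, Prop. 2.3 p. 89.
* [Keys1984] D. Keys, *Principal series representations of special unitary groups over local fields*, Compositio Math. 51 (1984), §3 pp. 118–119, §4 Thm. 3 p. 120.
* [BernsteinZelevinsky1977] I. N. Bernstein, A. V. Zelevinsky, *Induced representations of reductive p-adic groups I*, Ann. Sci. ÉNS 10 (1977), §2.3.
-/

set_option autoImplicit false

namespace Literature.RepresentationTheory

open Representation

section SelfExtensionCharSub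

variable {k : Type*} [Field k] {M : Type*} [Monoid M] {U : Type*} [AddCommGroup U] [Module k U]
  (N : Representation k M U) (χ : M →* k) (hχ : ∀ m, IsUnit (χ m)) (p : U →ₗ[k] k)
  (hquot : ∀ (m : M) (u : U), p (N m u) = χ m * p u) (hker : ∀ (m : M) (u : U), p u = 0 → N m u = χ m • u)
  {u₀ e : U} (hu₀ : p u₀ = 1) (he : p e = 0) (hline : ∀ w : U, p w = 0 → ∃ c : k, w = c • e) (hfree : ∀ c : k, c • e = 0 → c = 0)
  (χ₁ : Representation k M k) (hχ₁ : ∀ (m : M) (x : k), χ₁ m x = χ m * x)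

/-! ## §1 The non-split branch with its sub line -/

include hχ hquot hker hu₀ he hline hfree in
/-- **NON-SPLIT ⇒ AN INTERTWINER ONTO THE UNIPOTENT MODEL, MISSING ITS SUB AT `u₀` AND CARRYING THE SUB LINE `k·e` INTO THE SUB `0 × k`.**  If the self-extension does NOT split, its
scalar additive character `λ` is non-zero and for EVERY `N₀` of shape `λ` in the JET letters there is `θ : N → N₀` with `(θ u₀).1 = 1` and `θ e = (0, 1)` — ★ CHAR-EXT B's universal
isomorphism `Φ (x, y) = x e + y u₀` (`Φ⁻¹ u₀ = (0, 1)`, `Φ⁻¹ e = (1, 0)`) followed by the coordinate swap; consequently `(θ w).1 = 0` for every `w ∈ ker p = k·e`.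
[cite: Brown1982, Ch. IV §2 Prop. 2.1 p. 87, Prop. 2.3 p. 89] [cite: Keys1984, §3 pp. 118–119] -/
theorem exists_intertwiningMap_unipotentModel_of_not_split_sub (hns : ¬ ∃ v₀ : U, p v₀ = 1 ∧ ∀ m, N m v₀ = χ m • v₀) :
    ∃ lam : M → k, lam 1 = 0 ∧ (∀ m m' : M, lam (m * m') = lam m + lam m') ∧ (∃ m, lam m ≠ 0) ∧
      (∀ m : M, N m u₀ - χ m • u₀ = (χ m * lam m) • e) ∧
      ∀ (N₀ : Representation k M (k × k)), (∀ (m : M) (w : k × k), N₀ m w = (χ m * w.1, lam m * (χ m * w.1) + χ m * w.2)) →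
        ∃ θ : IntertwiningMap N N₀, (θ u₀).1 = 1 ∧ θ e = (0, 1) ∧ ∀ w : U, p w = 0 → (θ w).1 = 0 := by
  obtain ⟨lam, hlam1, hlammul, hΛ, hsplit⟩ := exists_scalar_additive N χ hχ p hquot hker hu₀ hline hfree
  refine ⟨lam, hlam1, hlammul, ?_, hΛ, fun N₀ hN₀ => ?_⟩
  · by_contra h
    push Not at h
    exact hns (hsplit.2 h)
  · obtain ⟨Φ, hΦ, -, hΦN⟩ := exists_linearEquiv_unipotent_model N χ p hker hu₀ he hline hfree lam hΛ
    -- `θ := swap ∘ Φ⁻¹`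
    let θl : U →ₗ[k] k × k := (LinearEquiv.prodComm k k k).toLinearMap ∘ₗ Φ.symm.toLinearMap
    have hθl : ∀ u : U, θl u = ((Φ.symm u).2, (Φ.symm u).1) := fun u => rfl
    have hθN : ∀ (m : M) (u : U), θl (N m u) = N₀ m (θl u) := fun m u => by
      obtain ⟨⟨x, y⟩, rfl⟩ := Φ.surjective u
      rw [hθl, hθl, hΦN, LinearEquiv.symm_apply_apply, LinearEquiv.symm_apply_apply, hN₀]
      ext <;> (dsimp only; try ring)
    have hu : Φ.symm u₀ = ((0 : k), (1 : k)) := by rw [LinearEquiv.symm_apply_eq, hΦ, zero_smul, one_smul, zero_add]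
    have heΦ : Φ.symm e = ((1 : k), (0 : k)) := by rw [LinearEquiv.symm_apply_eq, hΦ, one_smul, zero_smul, add_zero]
    have hθe : θl e = (0, 1) := by rw [hθl, heΦ]
    refine ⟨θl.intertwiningMap_of_isIntertwiningMap N N₀ hθN, ?_, ?_, fun w hw => ?_⟩
    · change (θl u₀).1 = 1
      rw [hθl, hu]
    · change θl e = (0, 1)
      exact hθe
    · obtain ⟨c, rfl⟩ := hline w hw
      change (θl (c • e)).1 = 0
      rw [map_smul, hθe, Prod.smul_fst, smul_zero]

/-! ## §2 The alternative with its sub line -/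

include hχ hquot hker hu₀ he hline hfree hχ₁ in
/-- **THE JACQUET ALTERNATIVE OF A SELF-EXTENSION OF A CHARACTER, WITH ITS SUB LINE** (the (d1′) input of the K4′ assembly ★ D′46): EITHER `2 ≤ dim_k Hom_M(N, χ₁)` (split: ★ row 40′
`two_le_finrank_intertwiningMap_of_split`) OR the scalar additive character `λ` is non-zero and for every model `N₀` of shape `λ` some intertwiner `θ : N → N₀` misses the sub
(`(θ y).1 ≠ 0`), carries `ker p` into the sub (`p w = 0 → (θ w).1 = 0`) and does not kill `e` (`θ e ≠ 0`).  At the CM datum: `N := r_B E`, `χ = θ̃` on `T(L⁺_v)`, `ker p = r_B(ι)(r_B π⁺)`.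
[cite: Brown1982, Ch. IV §2 Prop. 2.3 p. 89] [cite: Keys1984, §3 pp. 118–119; §4 Thm. 3 p. 120] [cite: BernsteinZelevinsky1977, §2.3] -/
theorem jacquetAlternative_of_selfExtension_char_sub :
    2 ≤ Module.finrank k (IntertwiningMap N χ₁) ∨
      ∃ lam : M → k, lam 1 = 0 ∧ (∀ m m' : M, lam (m * m') = lam m + lam m') ∧ (∃ m, lam m ≠ 0) ∧
        (∀ m : M, N m u₀ - χ m • u₀ = (χ m * lam m) • e) ∧
        ∀ (N₀ : Representation k M (k × k)), (∀ (m : M) (w : k × k), N₀ m w = (χ m * w.1, lam m * (χ m * w.1) + χ m * w.2)) →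
          ∃ θ : IntertwiningMap N N₀, (∃ y : U, (θ y).1 ≠ 0) ∧ (∀ w : U, p w = 0 → (θ w).1 = 0) ∧ θ e ≠ 0 := by
  by_cases hsplit : ∃ v₀ : U, p v₀ = 1 ∧ ∀ m, N m v₀ = χ m • v₀
  · obtain ⟨v₀, hv₀, hinv⟩ := hsplit
    exact Or.inl (two_le_finrank_intertwiningMap_of_split N χ hχ p hquot hker hu₀ he hline hfree χ₁ hχ₁ hv₀ hinv)
  · obtain ⟨lam, h1, hmul, hne, hocc, hθ⟩ := exists_intertwiningMap_unipotentModel_of_not_split_sub N χ hχ p hquot hker hu₀ he hline hfree hsplit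
    refine Or.inr ⟨lam, h1, hmul, hne, hocc, fun N₀ hN₀ => ?_⟩
    obtain ⟨θ, hθ1, hθe, hθsub⟩ := hθ N₀ hN₀
    refine ⟨θ, ⟨u₀, by rw [hθ1]; exact one_ne_zero⟩, hθsub, ?_⟩
    rw [hθe]
    exact fun h => one_ne_zero (congrArg Prod.snd h)

end SelfExtensionCharSub

end Literature.RepresentationTheory
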